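import Summits.Ventures.HodgeRepro2.T5SU11TailIntegralRatio
import Summits.Ventures.HodgeRepro2.T5SU11SphericalDecayEdge
import Summits.Ventures.HodgeRepro2.T5SU11SphericalDecayAsymptotic

/-!
# The exact decay rate at the spectral edge: `e^{t} χ_1(t) → π/2`

At `λ = 1` the regular solution is Harish-Chandra's `Ξ(a_t) ~ (4/π) t e^{−t}` (row 343) and the decaying solution
is `χ_1 = Ξ · T_1`, `T_1(t) = ∫_t^∞ ds/(sinh 2s Ξ(a_s)²)` (row 453). The integrand now has a POWER tail:
`e^{2t}/sinh 2t → 2` (row 450) and `e^{t} Ξ(a_t)/t → 4/π` give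

  **`t² / (sinh 2t · Ξ(a_t)²) → π²/8`**  (`tendsto_sq_mul_roIntegrand_sph_one`),

so row 454's power-tail comparison yields **`t · T_1(t) → π²/8`** (`tendsto_mul_tailIntegral_sph_one`) and

  **`e^{t} χ_1(t) → π/2`**  (`tendsto_exp_mul_sphDecay_one`):

at the bottom of the continuous spectrum the two solutions behave like `(4/π) t e^{−t}` and `(π/2) e^{−t}` — the
same exponent `−1 = −ρ`, the logarithmic (here linear in `t`) degeneracy of the Harish-Chandra expansion at
`λ = ρ` being carried entirely by `Ξ`. Nothing is claimed about (N).

Blind lane: Mathlib + the HodgeRepro2 prefix only; no sorry; axioms ⊆ {propext, Classical.choice,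
Quot.sound}.
-/

namespace Summit.Ventures.HodgeRepro2.T5SU11SphericalDecayEdgeAsymptotic

open Filter Topology MeasureTheory
open Set (Ioi)
open scoped Real
open T5SU11Cartan T5SU11SphericalFunction T5SU11SphericalBounds T5SU11SphericalXiAsymptotic
  T5SU11ReductionOfOrder T5SU11ReductionOfOrderInfinity T5SU11SphericalSolutionSpaceAll T5SU11SphericalDecay
  T5SU11SphericalDecayEdge T5SU11SphericalDecayAsymptotic T5SU11TailIntegralRatio

section measure

variable [MeasurableSpace Circle] [BorelSpace Circle]

/-- **`t² / (sinh 2t · Ξ(a_t)²) → π²/8`.** -/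
theorem tendsto_sq_mul_roIntegrand_sph_one :
    Tendsto (fun t => t ^ 2 * roIntegrand (fun t => sph 1 (hyp t)) t) atTop (𝓝 (π ^ 2 / 8)) := by
  have hπ := Real.pi_pos
  have h := tendsto_exp_div_sinh.mul ((tendsto_exp_mul_sph_one_hyp_div.inv₀ (by positivity)).pow 2)
  have e : (2 : ℝ) * ((4 / π)⁻¹) ^ 2 = π ^ 2 / 8 := by
    field_simp
    ring
  rw [e] at h
  refine h.congr' ?_
  filter_upwards [eventually_gt_atTop 0] with t ht
  have hS : Real.sinh (2 * t) ≠ 0 := (sinh_two_mul_pos ht).ne'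
  have hΞ : sph 1 (hyp t) ≠ 0 := (sph_hyp_pos 1 t).ne'
  have hE : Real.exp t ≠ 0 := (Real.exp_pos _).ne'
  have key : Real.exp t ^ 2 = Real.exp (2 * t) := by
    rw [← Real.exp_nat_mul]
    norm_num
  show Real.exp (2 * t) / Real.sinh (2 * t) * ((Real.exp t * sph 1 (hyp t) / t)⁻¹) ^ 2
    = t ^ 2 * (1 / (Real.sinh (2 * t) * sph 1 (hyp t) ^ 2))
  rw [← key]
  field_simp

/-- **`t · T_1(t) → π²/8`** for the tail integral at `λ = 1`. -/
theorem tendsto_mul_tailIntegral_sph_one :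
    Tendsto (fun t => t * tailIntegral (fun t => sph 1 (hyp t)) t) atTop (𝓝 (π ^ 2 / 8)) :=
  tendsto_mul_integral_Ioi_of_tendsto_sq_mul one_pos integrableOn_roIntegrand_sph_one
    tendsto_sq_mul_roIntegrand_sph_one

/-- **THE EXACT DECAY RATE AT THE EDGE: `e^{t} χ_1(t) → π/2`.** -/
theorem tendsto_exp_mul_sphDecay_one : Tendsto (fun t => Real.exp t * sphDecay 1 t) atTop (𝓝 (π / 2)) := by
  have hπ := Real.pi_pos
  have h := tendsto_exp_mul_sph_one_hyp_div.mul tendsto_mul_tailIntegral_sph_one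
  have e : 4 / π * (π ^ 2 / 8) = π / 2 := by
    field_simp
    ring
  rw [e] at h
  refine h.congr' ?_
  filter_upwards [eventually_gt_atTop 0] with t ht
  unfold sphDecay decaySolution
  field_simp

end measure

end Summit.Ventures.HodgeRepro2.T5SU11SphericalDecayEdgeAsymptotic
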